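import Summits.ABC.IUTFork.LDHSplitBadPrimeNumberField
import Summits.ABC.IUTFork.LDHSlotResiduePointPair
import Summits.ABC.IUTFork.LDHGenuinePoint
import Summits.ABC.IUTFork.LDHLocalProofData
import Summits.ABC.ABC.Theorems.IUTThetaPilotThetaPartIIDisplay
import HarnessLib

/-!
# The fork at [IUTchIII] Corollary 3.12, L-DH level: on the SPLIT-BAD LOCUS the (U)-line's Corollary stub is FREE and
# its computable-half stub (v4's CONE binder `hreg`) carries, BY ITSELF, [IUTchIV] Thm. 1.10's display at the point

Proof-only record file (D-0012; 0 definitions, no `Prop` fact) of the abc-iut cell (R2 S-CHAIN TEAM seat abc-iut-s2-p4,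
TARGET #1 «hvol residue»: close (ii′-U) at `d_mod > 1` or certify its Szpiro-type obstruction). TAKES NO SIDE on
[IUTchIII] Cor. 3.12 or on [IUTchIV] Thm. 1.10. S. Mochizuki, *IUT IV* [Mochizuki2012], Thm. 1.10 proof Step (v)
(kurims pp. 27–28, the symmetrisation in «`i† ∈ I`»), Step (viii) (pp. 30–31), Cor. 2.2 (ii) proof p. 46; Dupuy–Hilado
[DupuyHilado2025] §3.3, §3.6 (weights `Pr(v) = n_v/[F_mod:ℚ]`), §4.7 ((Ind1) = permutations of the tensor factors),
§4.10–4.12 (`hull(U_Θ)`, (1.1)); the cell's plan/c312/STEPV-IND1-NOTE.md (R2) and VERDICT RISK ¶7.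

THE TWO OPEN (U)-STUBS of crux `ThetaPartII` (stmt-ABC-19678, registered skeleton RESHAPE-2b, abc-iut-c312-8) are
`stub_cor312` (`Cor22.Cor312AtDatum P l`: for every genuine Θ-volume datum `T` at `(P,l)`, `−|log(q)| ≤ −|log(Θ)|` for the
DEFINED `−|log(Θ)|` of the hull of the UNION of the possible images — disputed) and `stub_hullRegime` (the computable half
`T.HullEstimateOf B_III(P,l)` at NON-slot-constant data; = the CONE binder `hreg` of the branch-C certificate
`Conditional.abc_of_S_v4`, p431657, and, without the regime antecedent, `hvol` of `abc_of_S_v3`, p430884). The tree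
knows (abc-iut-c312-3 `ThetaVolumeInput.cor312Of_of_badMass_le`, abc-iut-w5-d018 `…_le_half`, p430071): for EVERY genuine
Θ-volume input whose bad places over each support prime carry bad mass `β_p = Σ_{v|p, v∈𝕍^bad} Pr(v) ≤ 1/2`, the typed
`Cor312Of` HOLDS — the (Ind1) slot residue alone makes the union hull that large. THIS FILE reads that fact AT THE
`λ`-LINE and composes it with the point squeeze (abc-iut-S2 `PointDict.gap_eq`, abc-iut-c312-3/S2 `gap_le`) and with
abc-iut-S-d2's Step (viii) arithmetic `ThetaPartIIDisplay.display_of_squeezeIII`: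

* `PointDict.cor312Of_of_badMass_le_half` — a datum `T : Cor22.ThetaVolumeDatumAt P l` ON THE SPLIT-BAD LOCUS (its
  `𝕍^bad_mod` carries bad mass `≤ 1/2` over every support prime; e.g. `d_mod = 2` and every bad prime `∤ 2l` of `E_λ`
  split in `F_mod = ℚ(j(λ))` with a non-bad conjugate place) satisfies `T.Cor312NonarchOf ∧ T.Cor312Of`: the disputed
  stub is a THEOREM there; `cor312AtDatum_of_badMass_le_half` — the `∀ T` form `Cor22.Cor312AtDatum P l`.
* `PointDict.not_slotConstant_of_badMass_le_half` — such a datum is NEVER slot-constant (a bad and a non-bad place of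
  `F_mod` over one support prime have different canonical `log(q_v)`), so v4's regime antecedent fires: on the locus
  `hreg` and `hvol` say the same thing.
* **`PointDict.squeeze_of_hullEstimateOf_of_badMass_le_half`** — on the locus, `T.HullEstimateOf δ` ALONE gives the
  squeeze `((l+1)/24 − 1/(2l))·log(q^{∤{2,l}}(λ)) ≤ δ + ((l+5)/4)·log π` on the WHOLE `q`-degree of the point (no input
  from Cor. 3.12); **`display_of_hullEstimateOf_of_badMass_le_half`** — with `δ = B_III(P,l)`, `l ≠ 5`, `IsEtaPrm η`:
  `Cor22.Display P l η`, i.e. [IUTchIV] Thm. 1.10's inequality for the point as consumed by Cor. 2.2.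
* **`display_of_hreg_of_badMass_le_half`** / **`display_of_hvol_of_badMass_le_half`** — from a hypothesis with the EXACT
  type of v4's `hreg` (resp. v3's `hvol`): at every `P ∈ U_P` (minimal), prime `l ≥ 5` with `AdmitsCore/CondP2/CondP5/CondP6`
  and a datum on the split-bad locus, `Cor22.Display P l η` for every `IsEtaPrm η` — Cor.-3.12-FREE.

READING (for the C lead / §H / s2 SCOREBOARD; nothing asserted about print). On the split-bad locus of degree `≥ 2` the
union reading (U) moves the ENTIRE Diophantine content of [IUTchIV] Thm. 1.10 out of the Corollary stub (provably true
there) and into the computable-half stub: any kernel proof of `hreg`/`hvol` proves Thm. 1.10's display — an effective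
Szpiro/Vojta-type inequality `log q ≤ O_{d}(l)·(log-diff + log-cond) + O_d(l²)` — for EVERY admissible split-bad `λ`,
by volume computation plus number-field arithmetic alone; any kernel refutation exhibits an admissible split-bad `λ`
violating that display (an abc-violating configuration; none is known). Neither is a volume computation: this is the
kernel form of «(ii′-U) at `d_mod > 1` is Szpiro-type» (C-cert-2 «ABC_OF_S HYPS (7)» row (5); complementary to
abc-iut-S7's place-by-place necessity `PointDict.ordPair_le_of_hullVolumeAtDatum` and abc-iut-c312-d1's below-threshold
sufficiency `hullVolumeAtDatum_BIII_of_logQAvoid_le`). At `d_mod = 1` the locus is EMPTY (every bad prime is totally bad,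
abc-iut-w5-d018 `not_badMass_condition_of_finrank_eq_one`) and (ii′-U) is a theorem (abc-iut-S3/c312-d1, p425589/p425595).
HONEST SCOPE: consequences of the typed (U)-objects at genuine data ((Ind1) = all capsule-index permutations, R2); no datum
is constructed; no side taken on Cor. 3.12 / Thm. 1.10 or on any author; typed ≠ proved. PROOF-ONLY file.
[cite: Mochizuki2012, IUTchIV Thm. 1.10 Step (v) p. 27–28, Step (viii) p. 30–31] [cite: Mochizuki2012, IUTchIV Cor. 2.2 (ii) proof p. 46]
[cite: DupuyHilado2025, §3.3, §3.6, §4.7, §4.10–4.12] [claim: Mochizuki2012, status: disputed] for every IUT quotation.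
-/

noncomputable section

namespace Summit.ABC.IUTFork

open Literature.IUT.HodgeTheaters Literature.IUT.LogVolume NumberField IsDedekindDomain
open Literature.NumberTheory.DiophantineGeometry.GenEll
open Summit.ABC.ABC.Theorems

namespace PointDict

variable {P : NFPoint} {l : ℕ}

/-! ## The Corollary stub is FREE on the split-bad locus -/

/-- **On the split-bad locus the typed Cor. 3.12 HOLDS at the datum.** If the `𝕍^bad_mod` of the datum's initial Θ-data
carries bad mass `Σ_{v | p, v ∈ 𝕍^bad_mod} Pr(v) ≤ 1/2` over every support prime `p` of its genuine input, then
`T.Cor312NonarchOf` (Dupuy–Hilado (1.1)) and `T.Cor312Of` (`−|log(q)| ≤ −|log(Θ)|` for the DEFINED union-hull number)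
hold — abc-iut-w5-d018's `ThetaVolumeInput.cor312Of_of_badMass_le_half` read at the `λ`-line (the input's bad set IS
`𝕍^bad_mod`, abc-iut-S2 `IsVolumeInputOf.X_eq`). A theorem about OUR typed objects ((Ind1) = all capsule-index
permutations); nothing asserted about print's Cor. 3.12. [claim: Mochizuki2012, status: disputed]
[cite: DupuyHilado2025, §3.6, §4.7, §4.12] [cite: Mochizuki2012, IUTchIII Cor. 3.12 p. 173–174] -/
theorem cor312Of_of_badMass_le_half (T : Cor22.ThetaVolumeDatumAt P l)
    (hbad : letI := T.instFieldF; letI := T.instNumberFieldF; letI := T.instAlgebraF; letI := T.instFieldK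
      letI := T.instNumberFieldK; letI := T.instAlgebraK; letI := T.instFieldFbar; letI := T.instAlgebraFbar
      letI := T.instAlgebraKFbar; letI := T.instIsElliptic
      ∀ p ∈ T.I.supportPrimes, ∑ v : placesOver (fieldOfModuli T.E) p,
        ((ThetaData.badPrimesMod T.D : Finset _) : Set (HeightOneSpectrum (𝓞 (fieldOfModuli T.E)))).indicator
          (weight (fieldOfModuli T.E)) v.1 ≤ 1 / 2) :
    T.Cor312NonarchOf ∧ T.Cor312Of := by
  letI := T.instFieldF; letI := T.instNumberFieldF; letI := T.instAlgebraF; letI := T.instFieldK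
  letI := T.instNumberFieldK; letI := T.instAlgebraK; letI := T.instFieldFbar; letI := T.instAlgebraFbar
  letI := T.instAlgebraKFbar; letI := T.instIsElliptic
  have hS : T.I.X.S = ThetaData.badPrimesMod T.D := (X_S_eq T).1
  exact ThetaVolumeInput.cor312Of_of_badMass_le_half T.I fun p hp => by rw [hS]; exact hbad p hp

/-- **The `∀ T` form**: if EVERY genuine Θ-volume datum at `(P, l)` lies on the split-bad locus, then
`Cor22.Cor312NonarchAtDatum P l` and `Cor22.Cor312AtDatum P l` — the (U)-line's disputed stub `stub_cor312` at `(P, l)` —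
HOLD. (The bad mass is canonical in `(P, l)`: `𝕍^bad_mod` is the (P5) choice over `F_mod = ℚ(j(λ))`; the hypothesis is
kept datum by datum to stay inside the datum's carriers.) Nothing asserted about print. [claim: Mochizuki2012, status: disputed]
[cite: Mochizuki2012, IUTchIV Cor. 2.2 (ii) proof p. 46] -/
theorem cor312AtDatum_of_badMass_le_half
    (hbad : ∀ T : Cor22.ThetaVolumeDatumAt P l,
      letI := T.instFieldF; letI := T.instNumberFieldF; letI := T.instAlgebraF; letI := T.instFieldK
      letI := T.instNumberFieldK; letI := T.instAlgebraK; letI := T.instFieldFbar; letI := T.instAlgebraFbar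
      letI := T.instAlgebraKFbar; letI := T.instIsElliptic
      ∀ p ∈ T.I.supportPrimes, ∑ v : placesOver (fieldOfModuli T.E) p,
        ((ThetaData.badPrimesMod T.D : Finset _) : Set (HeightOneSpectrum (𝓞 (fieldOfModuli T.E)))).indicator
          (weight (fieldOfModuli T.E)) v.1 ≤ 1 / 2) :
    Cor22.Cor312NonarchAtDatum P l ∧ Cor22.Cor312AtDatum P l :=
  ⟨fun T => (cor312Of_of_badMass_le_half T (hbad T)).1, fun T => (cor312Of_of_badMass_le_half T (hbad T)).2⟩

/-! ## The split-bad locus is never slot-constant -/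

/-- The coefficient of `𝔮` at a bad place is `ord_v(q_v)`. [cite: DupuyHilado2025, §3.3] -/
private theorem qDivisor_apply_of_mem {F : Type} [Field F] [NumberField F] (X : PilotData F)
    {v : HeightOneSpectrum (𝓞 F)} (hv : v ∈ X.S) : X.qDivisor v = (X.ordq v : ℝ) := by
  classical
  simp only [PilotData.qDivisor, FinDivisor.of, Finsupp.finsetSum_apply, Finsupp.single_apply, Finset.sum_ite_eq',
    if_pos hv]

/-- Off `S` the coefficient of `𝔮` is `0`. [cite: DupuyHilado2025, §3.3] -/
private theorem qDivisor_apply_of_not_mem {F : Type} [Field F] [NumberField F] (X : PilotData F)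
    {v : HeightOneSpectrum (𝓞 F)} (hv : v ∉ X.S) : X.qDivisor v = 0 := by
  classical
  simp only [PilotData.qDivisor, FinDivisor.of, Finsupp.finsetSum_apply, Finsupp.single_apply, Finset.sum_ite_eq',
    if_neg hv]

/-- **A datum on the split-bad locus is NOT slot-constant**: some support prime carries a bad place `v ∈ 𝕍^bad_mod`
(`𝕍^bad_mod ≠ ∅`) and — the bad mass over it being `≤ 1/2 < 1 = Σ_{w|p} Pr(w)` — a place `w ∉ 𝕍^bad_mod`, and the
canonical `log(q_v) = ord_v(q_v)·ln N(v)/n_v > 0 = log(q_w)` (abc-iut-S2's `DHData.logQloc`). So the regime antecedent of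
the registered stub `stub_hullRegime` / v4's `hreg` holds at every datum of the locus. [cite: DupuyHilado2025, §3.3, §3.6]
[cite: Mochizuki2012, IUTchIV Def. 1.9 (ii) p. 22] -/
theorem not_slotConstant_of_badMass_le_half (T : Cor22.ThetaVolumeDatumAt P l)
    (hbad : letI := T.instFieldF; letI := T.instNumberFieldF; letI := T.instAlgebraF; letI := T.instFieldK
      letI := T.instNumberFieldK; letI := T.instAlgebraK; letI := T.instFieldFbar; letI := T.instAlgebraFbar
      letI := T.instAlgebraKFbar; letI := T.instIsElliptic
      ∀ p ∈ T.I.supportPrimes, ∑ v : placesOver (fieldOfModuli T.E) p,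
        ((ThetaData.badPrimesMod T.D : Finset _) : Set (HeightOneSpectrum (𝓞 (fieldOfModuli T.E)))).indicator
          (weight (fieldOfModuli T.E)) v.1 ≤ 1 / 2) :
    letI := T.instFieldF; letI := T.instNumberFieldF; letI := T.instAlgebraF; letI := T.instFieldK
    letI := T.instNumberFieldK; letI := T.instAlgebraK; letI := T.instFieldFbar; letI := T.instAlgebraFbar
    letI := T.instAlgebraKFbar; letI := T.instIsElliptic
    ¬ (∀ p ∈ T.I.supportPrimes, ∀ v w : placesOver (fieldOfModuli T.E) p,
      (Summit.ABC.IUTFork.DHData.ofInput T.I).logQloc p v = (Summit.ABC.IUTFork.DHData.ofInput T.I).logQloc p w) := by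
  classical
  letI := T.instFieldF; letI := T.instNumberFieldF; letI := T.instAlgebraF; letI := T.instFieldK
  letI := T.instNumberFieldK; letI := T.instAlgebraK; letI := T.instFieldFbar; letI := T.instAlgebraFbar
  letI := T.instAlgebraKFbar; letI := T.instIsElliptic
  intro hconst
  have hS : T.I.X.S = ThetaData.badPrimesMod T.D := (X_S_eq T).1
  -- a bad place `v₀` and its support prime `p`
  obtain ⟨v₀, hv₀⟩ := T.I.X.S_nonempty
  set p : ℕ := residueChar (fieldOfModuli T.E) v₀ with hpdef
  haveI hp : Fact p.Prime := ⟨residueChar_prime (fieldOfModuli T.E) v₀⟩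
  have hpT : p ∈ T.I.supportPrimes := T.I.residueChar_mem_supportPrimes hv₀
  have hv₀p : v₀ ∈ placesOver (fieldOfModuli T.E) p := (mem_placesOver_iff_residueChar v₀).mpr rfl
  -- a non-bad place `w` over the same prime: otherwise the bad mass over `p` is `Σ_{w|p} Pr(w) = 1 > 1/2`
  have hw : ∃ w : placesOver (fieldOfModuli T.E) p, w.1 ∉ T.I.X.S := by
    by_contra hall
    push Not at hall
    have hmass := hbad p hpT
    have heq : ∑ v : placesOver (fieldOfModuli T.E) p,
        ((ThetaData.badPrimesMod T.D : Finset _) : Set (HeightOneSpectrum (𝓞 (fieldOfModuli T.E)))).indicator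
          (weight (fieldOfModuli T.E)) v.1 = ∑ v : placesOver (fieldOfModuli T.E) p, weight (fieldOfModuli T.E) v.1 := by
      refine Finset.sum_congr rfl fun v _ => ?_
      have hv : v.1 ∈ ((ThetaData.badPrimesMod T.D : Finset _) : Set (HeightOneSpectrum (𝓞 (fieldOfModuli T.E)))) := by
        rw [← hS]; exact hall v
      exact Set.indicator_of_mem hv _
    rw [heq, PilotData.sum_weight_placesOver] at hmass
    norm_num at hmass
  obtain ⟨w, hwS⟩ := hw
  -- `log(q_{v₀}) > 0 = log(q_w)`
  have h1 : (Summit.ABC.IUTFork.DHData.ofInput T.I).logQloc p ⟨v₀, hv₀p⟩ =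
      (Summit.ABC.IUTFork.DHData.ofInput T.I).logQloc p w := hconst p hpT ⟨v₀, hv₀p⟩ w
  have hw0 : (Summit.ABC.IUTFork.DHData.ofInput T.I).logQloc p w = 0 := by
    rw [DHData.logQloc, DHData.ofInput_X, qDivisor_apply_of_not_mem T.I.X hwS, zero_mul, zero_div]
  have hv0 : 0 < (Summit.ABC.IUTFork.DHData.ofInput T.I).logQloc p ⟨v₀, hv₀p⟩ := by
    rw [DHData.logQloc, DHData.ofInput_X, qDivisor_apply_of_mem T.I.X hv₀]
    have h1 : (0 : ℝ) < (T.I.X.ordq v₀ : ℝ) := by exact_mod_cast T.I.X.ordq_pos hv₀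
    have h2 : 0 < logNorm (fieldOfModuli T.E) v₀ := logNorm_pos (fieldOfModuli T.E) v₀
    have h3 : (0 : ℝ) < (localDegree (fieldOfModuli T.E) v₀ : ℝ) := by
      exact_mod_cast localDegree_pos (fieldOfModuli T.E) v₀
    exact div_pos (mul_pos h1 h2) h3
  rw [h1, hw0] at hv0
  exact lt_irrefl _ hv0

/-! ## The computable half ALONE gives the squeeze and the display on the locus -/

/-- **On the split-bad locus the (U)-computable half ALONE yields the point squeeze.** For a genuine Θ-volume datum `T`
at `(P, l)` (`λ ∈ U_X`) whose `𝕍^bad_mod` has bad mass `≤ 1/2` over every support prime: `T.HullEstimateOf δ` implies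
`((l+1)/24 − 1/(2l))·log(q^{∤{2,l}}(λ)) ≤ δ + ((l+5)/4)·log π` — the inequality [IUTchIV] Thm. 1.10 Steps (viii)–(x)
rearrange into the display, here on the WHOLE `q`-degree of the point and with NO input from [IUTchIII] Cor. 3.12
(the typed `Cor312Of` being a theorem on the locus, `cor312Of_of_badMass_le_half`; squeeze = abc-iut-S2's
`Cor22.ThetaVolumeDatumAt.gap_le` + `PointDict.gap_eq`). Nothing asserted about any point. [claim: Mochizuki2012, status: disputed]
[cite: Mochizuki2012, IUTchIV Thm. 1.10 Step (viii) p. 30–31] [cite: DupuyHilado2025, §3.6, §4.12] -/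
theorem squeeze_of_hullEstimateOf_of_badMass_le_half (T : Cor22.ThetaVolumeDatumAt P l) (hU : P.InU)
    (hbad : letI := T.instFieldF; letI := T.instNumberFieldF; letI := T.instAlgebraF; letI := T.instFieldK
      letI := T.instNumberFieldK; letI := T.instAlgebraK; letI := T.instFieldFbar; letI := T.instAlgebraFbar
      letI := T.instAlgebraKFbar; letI := T.instIsElliptic
      ∀ p ∈ T.I.supportPrimes, ∑ v : placesOver (fieldOfModuli T.E) p,
        ((ThetaData.badPrimesMod T.D : Finset _) : Set (HeightOneSpectrum (𝓞 (fieldOfModuli T.E)))).indicator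
          (weight (fieldOfModuli T.E)) v.1 ≤ 1 / 2)
    {δ : ℝ} (h : T.HullEstimateOf δ) :
    (((l : ℝ) + 1) / 24 - 1 / (2 * l)) * Cor22.logQAvoid P {2, l} ≤ δ + ThetaVolumeInput.archLogTheta l := by
  rw [← gap_eq T hU]
  exact T.gap_le (cor312Of_of_badMass_le_half T hbad).2 h

/-- **The `∀ T` form of the squeeze**: if every datum at `(P, l)` lies on the split-bad locus, then
`Cor22.HullVolumeAtDatum P l δ` (the conclusion of `stub_hullVolume` / v3's `hvol` at `(P, l)`, there with `δ = B_III(P,l)`)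
implies the point squeeze for every datum, Cor.-3.12-free. [claim: Mochizuki2012, status: disputed]
[cite: Mochizuki2012, IUTchIV Thm. 1.10 Step (viii) p. 30–31] -/
theorem squeeze_of_hullVolumeAtDatum_of_badMass_le_half (hU : P.InU) {δ : ℝ} (h : Cor22.HullVolumeAtDatum P l δ)
    (T : Cor22.ThetaVolumeDatumAt P l)
    (hbad : letI := T.instFieldF; letI := T.instNumberFieldF; letI := T.instAlgebraF; letI := T.instFieldK
      letI := T.instNumberFieldK; letI := T.instAlgebraK; letI := T.instFieldFbar; letI := T.instAlgebraFbar
      letI := T.instAlgebraKFbar; letI := T.instIsElliptic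
      ∀ p ∈ T.I.supportPrimes, ∑ v : placesOver (fieldOfModuli T.E) p,
        ((ThetaData.badPrimesMod T.D : Finset _) : Set (HeightOneSpectrum (𝓞 (fieldOfModuli T.E)))).indicator
          (weight (fieldOfModuli T.E)) v.1 ≤ 1 / 2) :
    (((l : ℝ) + 1) / 24 - 1 / (2 * l)) * Cor22.logQAvoid P {2, l} ≤ δ + ThetaVolumeInput.archLogTheta l :=
  squeeze_of_hullEstimateOf_of_badMass_le_half T hU hbad (h T)

/-- **On the split-bad locus the (U)-computable half with print's `B_III(P,l)` ALONE yields [IUTchIV] Thm. 1.10's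
display at the point**: `λ ∈ U_X`, `l ≥ 5` prime with `l ≠ 5`, `IsEtaPrm η`, a datum `T` at `(P, l)` of bad mass `≤ 1/2`
over every support prime, and `T.HullEstimateOf (B_III P l)` (exact registered bytes) ⟹ `Cor22.Display P l η`
(abc-iut-S-d2's Step (viii) arithmetic `ThetaPartIIDisplay.display_of_squeezeIII` after the Cor.-3.12-free squeeze).
So on the locus any proof of the computable-half stub proves the display — an effective Szpiro/Vojta-type inequality
on `log(q^{∤{2,l}}(λ))` — outright. Nothing asserted about any point; no side taken. [claim: Mochizuki2012, status: disputed]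
[cite: Mochizuki2012, IUTchIV Thm. 1.10 Steps (v), (viii) p. 27–31] -/
theorem display_of_hullEstimateOf_of_badMass_le_half (T : Cor22.ThetaVolumeDatumAt P l) (hU : P.InU)
    (hl : l.Prime) (h5 : 5 ≤ l) (hne : l ≠ 5) {η : ℝ} (hη : IsEtaPrm η)
    (hbad : letI := T.instFieldF; letI := T.instNumberFieldF; letI := T.instAlgebraF; letI := T.instFieldK
      letI := T.instNumberFieldK; letI := T.instAlgebraK; letI := T.instFieldFbar; letI := T.instAlgebraFbar
      letI := T.instAlgebraKFbar; letI := T.instIsElliptic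
      ∀ p ∈ T.I.supportPrimes, ∑ v : placesOver (fieldOfModuli T.E) p,
        ((ThetaData.badPrimesMod T.D : Finset _) : Set (HeightOneSpectrum (𝓞 (fieldOfModuli T.E)))).indicator
          (weight (fieldOfModuli T.E)) v.1 ≤ 1 / 2)
    (h : T.HullEstimateOf
      (((l : ℝ) + 1) / 4 *
        ((1 + 12 * (Cor22.dmod P : ℝ) / l) * (P.logDiff + Cor22.logCondAvoid P {2, l})
          + 2 * Real.log l + 52
          + 20 / 3 * Real.log (((2 ^ 12 * 3 ^ 3 * 5 * Cor22.dmod P : ℕ) : ℝ) * (l : ℝ))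
            * (Nat.primeCounting (2 ^ 12 * 3 ^ 3 * 5 * Cor22.dmod P * l) : ℝ)))) :
    Cor22.Display P l η :=
  ThetaPartIIDisplay.display_of_squeezeIII hl h5 hne hη (squeeze_of_hullEstimateOf_of_badMass_le_half T hU hbad h)

end PointDict

/-! ## From the certificate binders `hreg` (v4) / `hvol` (v3), verbatim -/

open PointDict

/-- (P6) fails at `l = 5` for a point of `U_X` (abc-iut-S-d1: a theta field exists and carries the `5`-torsion), so an
admissible `l ≥ 5` is `≠ 5`. [cite: Mochizuki2012, IUTchIV Cor. 2.2 (ii) proof p. 46] -/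
private theorem ne_five_of_condP6 {P : NFPoint} (hU : P.InU) {l : ℕ} (h6 : Cor22.CondP6 P l) : l ≠ 5 := by
  rintro rfl
  obtain ⟨F, hNF, hF⟩ := Cor22.exists_isThetaField (P := P) hU
  exact Cor22.not_condP6_five_of_isThetaField hU F hF h6

/-- **v4's CONE binder `hreg` ALONE gives Thm. 1.10's display on the split-bad locus.** From a hypothesis with the EXACT
type of the binder `hreg` of `Conditional.abc_of_S_v4` (p431657; = the body of the registered stub `stub_hullRegime` of
crux `ThetaPartII`, stmt-ABC-19678): at every `P ∈ U_P` (minimally presented `λ ∈ U_X`), prime `l ≥ 5` with `AdmitsCore`,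
`CondP2`, `CondP5`, `CondP6`, and every genuine Θ-volume datum `T` at `(P, l)` whose `𝕍^bad_mod` has bad mass `≤ 1/2` over
every support prime, `Cor22.Display P l η` holds for every `IsEtaPrm η` — with NO input from [IUTchIII] Cor. 3.12 (typed
`Cor312Of` is a theorem on the locus) and the regime antecedent discharged (`not_slotConstant_of_badMass_le_half`).
READING: on the locus, closing `hreg` = proving [IUTchIV] Thm. 1.10's inequality for those points outright (Szpiro-type);
refuting `hreg` = exhibiting an admissible split-bad `λ` violating it. Nothing asserted about any point or about print;
no side taken. [claim: Mochizuki2012, status: disputed] [cite: Mochizuki2012, IUTchIV Thm. 1.10 Steps (v), (viii) p. 27–31]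
[cite: Mochizuki2012, IUTchIV Cor. 2.2 (ii) proof p. 46] -/
theorem display_of_hreg_of_badMass_le_half
    (hreg : ∀ P : NFPoint, P ∈ UP → ∀ l : ℕ, l.Prime → 5 ≤ l →
      Cor22.AdmitsCore P → Cor22.CondP2 P l → Cor22.CondP5 P l → Cor22.CondP6 P l →
      ∀ T : Cor22.ThetaVolumeDatumAt P l,
        (letI := T.instFieldF; letI := T.instNumberFieldF; letI := T.instAlgebraF; letI := T.instFieldK
         letI := T.instNumberFieldK; letI := T.instAlgebraK; letI := T.instFieldFbar; letI := T.instAlgebraFbar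
         letI := T.instAlgebraKFbar; letI := T.instIsElliptic
         ¬ (∀ p ∈ T.I.supportPrimes, ∀ v w : placesOver (fieldOfModuli T.E) p,
            (Summit.ABC.IUTFork.DHData.ofInput T.I).logQloc p v = (Summit.ABC.IUTFork.DHData.ofInput T.I).logQloc p w)) →
        T.HullEstimateOf
          (((l : ℝ) + 1) / 4 *
            ((1 + 12 * (Cor22.dmod P : ℝ) / l) * (P.logDiff + Cor22.logCondAvoid P {2, l})
              + 2 * Real.log l + 52
              + 20 / 3 * Real.log (((2 ^ 12 * 3 ^ 3 * 5 * Cor22.dmod P : ℕ) : ℝ) * (l : ℝ))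
                * (Nat.primeCounting (2 ^ 12 * 3 ^ 3 * 5 * Cor22.dmod P * l) : ℝ))))
    {P : NFPoint} (hP : P ∈ UP) {l : ℕ} (hl : l.Prime) (h5 : 5 ≤ l) (hc : Cor22.AdmitsCore P)
    (h2 : Cor22.CondP2 P l) (h5' : Cor22.CondP5 P l) (h6 : Cor22.CondP6 P l) (T : Cor22.ThetaVolumeDatumAt P l)
    (hbad : letI := T.instFieldF; letI := T.instNumberFieldF; letI := T.instAlgebraF; letI := T.instFieldK
      letI := T.instNumberFieldK; letI := T.instAlgebraK; letI := T.instFieldFbar; letI := T.instAlgebraFbar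
      letI := T.instAlgebraKFbar; letI := T.instIsElliptic
      ∀ p ∈ T.I.supportPrimes, ∑ v : placesOver (fieldOfModuli T.E) p,
        ((ThetaData.badPrimesMod T.D : Finset _) : Set (HeightOneSpectrum (𝓞 (fieldOfModuli T.E)))).indicator
          (weight (fieldOfModuli T.E)) v.1 ≤ 1 / 2)
    {η : ℝ} (hη : IsEtaPrm η) :
    Cor22.Display P l η :=
  display_of_hullEstimateOf_of_badMass_le_half T hP.1 hl h5 (ne_five_of_condP6 hP.1 h6) hη hbad
    (hreg P hP l hl h5 hc h2 h5' h6 T (not_slotConstant_of_badMass_le_half T hbad))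

/-- **The squeeze form of the same** (no `η`, no `l ≠ 5`): from v4's `hreg` verbatim, on the split-bad locus,
`((l+1)/24 − 1/(2l))·log(q^{∤{2,l}}(λ)) ≤ B_III(P,l) + ((l+5)/4)·log π`. [claim: Mochizuki2012, status: disputed]
[cite: Mochizuki2012, IUTchIV Thm. 1.10 Step (viii) p. 30–31] -/
theorem squeeze_of_hreg_of_badMass_le_half
    (hreg : ∀ P : NFPoint, P ∈ UP → ∀ l : ℕ, l.Prime → 5 ≤ l →
      Cor22.AdmitsCore P → Cor22.CondP2 P l → Cor22.CondP5 P l → Cor22.CondP6 P l →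
      ∀ T : Cor22.ThetaVolumeDatumAt P l,
        (letI := T.instFieldF; letI := T.instNumberFieldF; letI := T.instAlgebraF; letI := T.instFieldK
         letI := T.instNumberFieldK; letI := T.instAlgebraK; letI := T.instFieldFbar; letI := T.instAlgebraFbar
         letI := T.instAlgebraKFbar; letI := T.instIsElliptic
         ¬ (∀ p ∈ T.I.supportPrimes, ∀ v w : placesOver (fieldOfModuli T.E) p,
            (Summit.ABC.IUTFork.DHData.ofInput T.I).logQloc p v = (Summit.ABC.IUTFork.DHData.ofInput T.I).logQloc p w)) →
        T.HullEstimateOf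
          (((l : ℝ) + 1) / 4 *
            ((1 + 12 * (Cor22.dmod P : ℝ) / l) * (P.logDiff + Cor22.logCondAvoid P {2, l})
              + 2 * Real.log l + 52
              + 20 / 3 * Real.log (((2 ^ 12 * 3 ^ 3 * 5 * Cor22.dmod P : ℕ) : ℝ) * (l : ℝ))
                * (Nat.primeCounting (2 ^ 12 * 3 ^ 3 * 5 * Cor22.dmod P * l) : ℝ))))
    {P : NFPoint} (hP : P ∈ UP) {l : ℕ} (hl : l.Prime) (h5 : 5 ≤ l) (hc : Cor22.AdmitsCore P)
    (h2 : Cor22.CondP2 P l) (h5' : Cor22.CondP5 P l) (h6 : Cor22.CondP6 P l) (T : Cor22.ThetaVolumeDatumAt P l)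
    (hbad : letI := T.instFieldF; letI := T.instNumberFieldF; letI := T.instAlgebraF; letI := T.instFieldK
      letI := T.instNumberFieldK; letI := T.instAlgebraK; letI := T.instFieldFbar; letI := T.instAlgebraFbar
      letI := T.instAlgebraKFbar; letI := T.instIsElliptic
      ∀ p ∈ T.I.supportPrimes, ∑ v : placesOver (fieldOfModuli T.E) p,
        ((ThetaData.badPrimesMod T.D : Finset _) : Set (HeightOneSpectrum (𝓞 (fieldOfModuli T.E)))).indicator
          (weight (fieldOfModuli T.E)) v.1 ≤ 1 / 2) :
    (((l : ℝ) + 1) / 24 - 1 / (2 * l)) * Cor22.logQAvoid P {2, l} ≤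
      ((l : ℝ) + 1) / 4 *
          ((1 + 12 * (Cor22.dmod P : ℝ) / l) * (P.logDiff + Cor22.logCondAvoid P {2, l})
            + 2 * Real.log l + 52
            + 20 / 3 * Real.log (((2 ^ 12 * 3 ^ 3 * 5 * Cor22.dmod P : ℕ) : ℝ) * (l : ℝ))
              * (Nat.primeCounting (2 ^ 12 * 3 ^ 3 * 5 * Cor22.dmod P * l) : ℝ))
        + ThetaVolumeInput.archLogTheta l :=
  squeeze_of_hullEstimateOf_of_badMass_le_half T hP.1 hbad
    (hreg P hP l hl h5 hc h2 h5' h6 T (not_slotConstant_of_badMass_le_half T hbad))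

/-- **v3's CONE binder `hvol` ALONE gives Thm. 1.10's display on the split-bad locus** — the same from a hypothesis with
the EXACT type of the binder `hvol` of `Conditional.abc_of_S_v3` (p430884; = the body of the former stub `stub_hullVolume`):
at every admissible `(P, l)` and every datum of bad mass `≤ 1/2` over each support prime, `Cor22.Display P l η` for every
`IsEtaPrm η`, Cor.-3.12-free. Nothing asserted about any point; no side taken. [claim: Mochizuki2012, status: disputed]
[cite: Mochizuki2012, IUTchIV Thm. 1.10 Steps (v), (viii) p. 27–31] [cite: Mochizuki2012, IUTchIV Cor. 2.2 (ii) proof p. 46] -/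
theorem display_of_hvol_of_badMass_le_half
    (hvol : ∀ P₀ : NFPoint, P₀ ∈ UP → ∀ l : ℕ, l.Prime → 5 ≤ l →
      Cor22.AdmitsCore P₀ → Cor22.CondP2 P₀ l → Cor22.CondP5 P₀ l → Cor22.CondP6 P₀ l →
        Cor22.HullVolumeAtDatum P₀ l (((l : ℝ) + 1) / 4 *
          ((1 + 12 * (Cor22.dmod P₀ : ℝ) / l) * (P₀.logDiff + Cor22.logCondAvoid P₀ {2, l})
            + 2 * Real.log l + 52
            + 20 / 3 * Real.log (((2 ^ 12 * 3 ^ 3 * 5 * Cor22.dmod P₀ : ℕ) : ℝ) * (l : ℝ))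
              * (Nat.primeCounting (2 ^ 12 * 3 ^ 3 * 5 * Cor22.dmod P₀ * l) : ℝ))))
    {P : NFPoint} (hP : P ∈ UP) {l : ℕ} (hl : l.Prime) (h5 : 5 ≤ l) (hc : Cor22.AdmitsCore P)
    (h2 : Cor22.CondP2 P l) (h5' : Cor22.CondP5 P l) (h6 : Cor22.CondP6 P l) (T : Cor22.ThetaVolumeDatumAt P l)
    (hbad : letI := T.instFieldF; letI := T.instNumberFieldF; letI := T.instAlgebraF; letI := T.instFieldK
      letI := T.instNumberFieldK; letI := T.instAlgebraK; letI := T.instFieldFbar; letI := T.instAlgebraFbar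
      letI := T.instAlgebraKFbar; letI := T.instIsElliptic
      ∀ p ∈ T.I.supportPrimes, ∑ v : placesOver (fieldOfModuli T.E) p,
        ((ThetaData.badPrimesMod T.D : Finset _) : Set (HeightOneSpectrum (𝓞 (fieldOfModuli T.E)))).indicator
          (weight (fieldOfModuli T.E)) v.1 ≤ 1 / 2)
    {η : ℝ} (hη : IsEtaPrm η) :
    Cor22.Display P l η :=
  display_of_hullEstimateOf_of_badMass_le_half T hP.1 hl h5 (ne_five_of_condP6 hP.1 h6) hη hbad
    (hvol P hP l hl h5 hc h2 h5' h6 T)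

end Summit.ABC.IUTFork

end
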